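import Summits.Ventures.CertifiedManyBodySolver.Rows.CARPolyWindowSyntax
import Summits.Ventures.CertifiedManyBodySolver.Rows.CARPolyWindowResidual
import Summits.Ventures.CertifiedManyBodySolver.Rows.DopedTLCorrFilling
import Literature.MathematicalPhysics.QuantumLattice.HubbardNNNHoppingTorusLimitCorrelatorAffine
import HarnessLib

/-!
# KERNEL FORM of the `t–t'` window-certificate soundness: the claim-node shape `SquareTTPrimeCorrAffineOrbitLowerRowN`
# (hence every affine / window row of an OBS vertex node) from SYNTACTIC certificate data and ONE rational inequality
# `q ≤ lowerConst (normalize (residual))` — NO certificate identity hypothesis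

HONEST FRAMING: Lean plumbing towards «tier P» (an SDP vertex certificate becoming a kernel theorem): the theorem below discharges
the IDENTITY hypothesis `hcert` of the tree's soundness theorems by a computation the kernel can evaluate; it does NOT discharge any
existing claim node (that needs the exporter to this data shape + the evaluation — HOME/hubbard-obs-p2/TIER-P-SIZING-g22-ADDENDUM.md);
no number of record moves; the rows are CONTROL/CALIBRATION stiffness-scale CEILINGS (wording (xx1)), silent on the presence of
superconductivity; not a `T_c` or phase sentence; nothing about any material; no summit statement is proved by this file. Seat
hubbard-obs-p2 (STIFFNESS), `prover-hubbard-obs-p2-g22-0`, zero compute.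

THE STATEMENT (`affineOrbitLowerRowN_of_kernelCert`). Fix the `t–t'` square lattice at `t = 1`, NNN hopping `tp`, coupling `U ≥ 0`
(both rational here), a window `Λ ⊆ Λ'` (`thicken Λ 1 ⊆ Λ'`, `thicken {0} 1 ⊆ Λ'`), a label set `S ∋ 1` closed under products, an
injective letter map `d : α → Orb (PolySite Λ')` (syntax letters → window orbitals) and an inner letter map `dΛ : β → Orb (PolySite Λ)`
with its syntactic inclusion `f : β → α` (`d ∘ f = embMap(incl) ∘ dΛ`). DICTIONARY HYPOTHESES (proved once per window, not per
certificate): term lists `TH`, `TE` with `termOp d TH = H^{1,tp,U}_{Λ'}` (window Hamiltonian) and `termOp d TE = Γ(incl) E_Φ` (mean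
energy observable), and origin letters `o σ` with `d (o σ) = (0, σ)`. CERTIFICATE DATA (all syntactic): objective `TX`; density
multipliers `μ σ`, slot `ν`; energy multipliers `κhi, κlo` with levels `hi, lo` (EITHER sign); SOS factors `Q` at dyadic scale `K`
(`Gram = Σ (2^{−K}q)†(2^{−K}q)`, PSD by construction); eom words `EB` over inner letters; licensed affine-`D₄` moves `(γₗ ∈ S, vₗ)`
with syntactic letter maps `g l` (`d ∘ g l = embMap(incl) ∘ embMap(d4Emb γₗ vₗ) ∘ dΛ`) acting on inner words `SY l`; charged words
`CW` (charge or spin-charge ≠ 0, decided on the syntax); anti-Hermitian parts `AV`. CONCLUSION: for all rational `q, s, n₀` with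
`s = (μ 0 + μ 1)/2` and
  `q ≤ lowerConst (normalize enc B (residT …)) + (μ 0 + μ 1)·(n₀/2 − ν)`                                   (★, decidable)
the affine-N claim-node predicate `SquareTTPrimeCorrAffineOrbitLowerRowN tp U q hi lo κhi κlo s n₀ S Λ' (termOp d TX)` HOLDS —
i.e. for every density `x ∈ [0,2)` and every torus limit `ω` of unit sector ground states,
`q + s(x − n₀) + κhi(hi − e₀) + κlo(e₀ − lo) ≤ |S|⁻¹ Σ_γ Re ω_γ(Γ(d4Emb γ 0) (termOp d TX))`. PROOF: the residual
`residT = TX − Σ_σ μ_σ (n_{0σ} − ν) − κhi (hi − TE) − κlo (TE − lo) − gramT − eomT − symT − CW − ahT` denotes (dictionaries + the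
term-list algebra of `Rows/CARPolyWindowSyntax.lean`) exactly `X − (density rows) − (energy rows) − (Han's families)`; its collected
normal form `R` denotes the same operator (`evalPoly_normalize`) and splits as `constCoeff R · 1 + Σ_k aₖ wₖ`
(`Rows/CARPolyWindowResidual.lean`); so the tree's identity `hcert` HOLDS with `c := constCoeff R` and residual family `(aₖ, wₖ)`,
and `IsTorusLimitOf.re_sum_expect_d4_ge_of_window_certificate_TT'_affine₂` (Literature, p658585) gives the row with
`c − Σ‖aₖ‖ = lowerConst R`. Every other node shape then follows by the existing solver-free edges of
`Rows/DopedTLCorrFilling.lean` (`…N.affineOrbitLowerRow_at` — the fixed-density affine row; `…N.rowWN` / `…N.rowWN_self` — the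
window-N rows when `κhi, κlo ≥ 0`; `…WN.orbitRowW_at` — the two-row point predicate).

WHAT A USER STILL OWES (per window, not per certificate): the two dictionary equalities `hH`, `hE`, the letter-map equalities `hf`,
`hg`, `ho`, `hsp` (on concrete windows: `decide`/`rfl`-class), the geometric side conditions of the Literature theorem — and the
evaluation of (★) (`decide +kernel` at quantum-chemistry scale; `native_decide`/sharded replay at EXT5-L⁺ scale: tier P3).

References: J. Wang et al., PRX 14 (2024) 031006 §III [WangEtAl2024]; X. Han, arXiv:2006.06002 §3 [Han2020Bootstrap]; C. Jansson,
D. Chaykin, C. Keil, SIAM J. Numer. Anal. 46 (2008) 180 [JanssonChaykinKeil2008]; S. Boyd, L. Vandenberghe, *Convex Optimization* §5.6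
[BoydVandenberghe2004].
-/

noncomputable section

namespace Summit.Ventures.CertifiedManyBodySolver

namespace CARPolyWindow

open Summit.Ventures.CertifiedQuantumChemistry Summit.Ventures.CertifiedQuantumChemistry.CARPoly
open Literature.MathematicalPhysics.QuantumLattice Literature.MathematicalPhysics.QuantumLattice.HubbardWave0
open Literature.MathematicalPhysics.QuantumManyBody.StateRelaxation
open Literature.Probability.LatticeModels ThermodynamicLimit Filter Topology
open Matrix
open scoped ComplexOrder BigOperators

/-! ## The syntactic residual of a window certificate -/

section Residual

variable {α β : Type*}

/-- The density word `n_{0σ} − ν·1` at the origin letter `o σ`. [cite: Han2020Bootstrap, §3] -/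
def densT (o : Fin 2 → α) (ν : ℚ) (σ : Fin 2) : Terms α := [([(o σ, true), (o σ, false)], 1), ([], -ν)]

/-- Equation-of-motion list over INNER words pushed along `f`: `Σ_k (H·Γ(B_k) − Γ(B_k)·H)`. [cite: Han2020Bootstrap, §3] -/
def eomTβ (H : Terms α) (f : β → α) (Bs : List (Terms β)) : Terms α := Bs.flatMap fun B => commT H (wmapT f B)

/-- Symmetry-identification list: `Σ_l (Γ(γₗ·Yₗ + vₗ) − Γ(Yₗ))` with the moved letters `g l` and the plain inclusion `f`.
[cite: Han2020Bootstrap, §3] -/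
def symT (f : β → α) {nS : ℕ} (g : Fin nS → β → α) (SY : Fin nS → Terms β) : Terms α :=
  (finL nS).flatMap fun l => wmapT (g l) (SY l) ++ negT (wmapT f (SY l))

/-- Anti-Hermitian parts: `Σ_V (V† − V)`. [cite: Han2020Bootstrap, §3] -/
def ahT (AV : List (Terms α)) : Terms α := AV.flatMap fun V => daggerT V ++ negT V

/-- **The RESIDUAL term list of a window certificate**: objective minus density rows minus energy rows minus Gram minus eom minus
symmetry identifications minus charged words minus anti-Hermitian parts. Its collected normal form carries the bound
(`lowerConst`). [cite: WangEtAl2024, §III] -/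
def residT (TX : Terms α) (μ : Fin 2 → ℚ) (ν : ℚ) (o : Fin 2 → α) (κhi hi κlo lo : ℚ) (TE : Terms α)
    (K : ℕ) (Q : List (Terms α)) (TH : Terms α) (f : β → α) (EB : List (Terms β))
    {nS : ℕ} (g : Fin nS → β → α) (SY : Fin nS → Terms β) (CW : Terms α) (AV : List (Terms α)) : Terms α :=
  TX ++ negT ((finL 2).flatMap fun σ => scaleT (μ σ) (densT o ν σ))
    ++ negT (scaleT κhi (unitT hi ++ negT TE)) ++ negT (scaleT κlo (TE ++ unitT (-lo)))
    ++ negT (gramT K Q) ++ negT (eomTβ TH f EB) ++ negT (symT f g SY) ++ negT CW ++ negT (ahT AV)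

end Residual

/-! ## Semantics of the residual -/

section Semantics

variable {α β : Type*} {Λ Λ' : Finset (Site 2)}

/-- The density word denotes `n_{0σ} − ν·1`. [cite: Han2020Bootstrap, §3] -/
theorem termOp_densT (d : α → Orb (PolySite Λ')) (hz : (0 : Site 2) ∈ Λ') (o : Fin 2 → α)
    (ho : ∀ σ, d (o σ) = orb (PolySite.pt 0 hz) σ) (ν : ℚ) (σ : Fin 2) :
    termOp d (densT o ν σ) = nAt 0 hz σ - ((ν : ℚ) : ℂ) • (1 : FermionOp Λ') := by
  rw [densT, termOp_cons, termOp_cons, termOp_nil, add_zero, Rat.cast_one, one_smul, Rat.cast_neg, neg_smul,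
    ← sub_eq_add_neg]
  congr 1
  simp only [wmap, List.map_cons, List.map_nil, ladderWord_cons, ladderWord_nil, mul_one, ladderLetter, if_true,
    Bool.false_eq_true, if_false, ho]
  rfl

/-- `eomTβ` denotes `Σ_k (H·Γ(incl)(B_k) − Γ(incl)(B_k)·H)` with `B_k = termOp dΛ (EB k) ∈ 𝔄_Λ`. [cite: Han2020Bootstrap, §3] -/
theorem termOp_eomTβ (hΛ : Λ ⊆ Λ') (d : α → Orb (PolySite Λ')) (dΛ : β → Orb (PolySite Λ)) (f : β → α)
    (hf : ∀ b, d (f b) = Orb.embMap (PolySite.incl hΛ) (dΛ b)) (TH : Terms α) (EB : List (Terms β)) :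
    termOp d (eomTβ TH f EB) = ∑ k : Fin EB.length,
      (termOp d TH * fermionEmbed (PolySite.incl hΛ) (termOp dΛ (EB.get k)) -
        fermionEmbed (PolySite.incl hΛ) (termOp dΛ (EB.get k)) * termOp d TH) := by
  rw [eomTβ, termOp_flatMap_get]
  refine Finset.sum_congr rfl fun k _ => ?_
  have hdf : d ∘ f = Orb.embMap (PolySite.incl hΛ) ∘ dΛ := funext hf
  rw [termOp_commT, termOp_wmapT, fermionEmbed_termOp, hdf]

/-- `symT` denotes `Σ_l (Γ(incl)(Γ(d4Emb γₗ vₗ) Y_l) − Γ(incl) Y_l)` with `Y_l = termOp dΛ (SY l) ∈ 𝔄_Λ`. [cite: Han2020Bootstrap, §3] -/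
theorem termOp_symT (hΛ : Λ ⊆ Λ') (d : α → Orb (PolySite Λ')) (dΛ : β → Orb (PolySite Λ)) (f : β → α)
    (hf : ∀ b, d (f b) = Orb.embMap (PolySite.incl hΛ) (dΛ b))
    {nS : ℕ} (γ : Fin nS → DihedralGroup 4) (wv : Fin nS → Site 2) (hsh : ∀ l, d4ShiftSet (γ l) (wv l) Λ ⊆ Λ')
    (g : Fin nS → β → α)
    (hg : ∀ l b, d (g l b) = Orb.embMap (PolySite.incl (hsh l)) (Orb.embMap (PolySite.d4Emb (γ l) (wv l) Λ) (dΛ b)))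
    (SY : Fin nS → Terms β) :
    termOp d (symT f g SY) = ∑ l : Fin nS,
      (fermionEmbed (PolySite.incl (hsh l)) (fermionEmbed (PolySite.d4Emb (γ l) (wv l) Λ) (termOp dΛ (SY l))) -
        fermionEmbed (PolySite.incl hΛ) (termOp dΛ (SY l))) := by
  rw [symT, termOp_flatMap_finL]
  refine Finset.sum_congr rfl fun l _ => ?_
  have hdf : d ∘ f = Orb.embMap (PolySite.incl hΛ) ∘ dΛ := funext hf
  have hdg : d ∘ g l = Orb.embMap (PolySite.incl (hsh l)) ∘ (Orb.embMap (PolySite.d4Emb (γ l) (wv l) Λ) ∘ dΛ) :=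
    funext (hg l)
  rw [termOp_append, termOp_negT, termOp_wmapT, termOp_wmapT, fermionEmbed_termOp, fermionEmbed_termOp,
    fermionEmbed_termOp, hdf, hdg, sub_eq_add_neg]

/-- `ahT` denotes `Σ_m (1 : ℝ) • (V_mᴴ − V_m)`. [cite: Han2020Bootstrap, §3] -/
theorem termOp_ahT {ι : Type*} [LinearOrder ι] [Fintype ι] (d : α → ι) (AV : List (Terms α)) :
    termOp d (ahT AV) = ∑ m : Fin AV.length, (((1 : ℝ) : ℝ) : ℂ) • ((termOp d (AV.get m))ᴴ - termOp d (AV.get m)) := by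
  rw [ahT, termOp_flatMap_get]
  refine Finset.sum_congr rfl fun m _ => ?_
  rw [termOp_append, termOp_negT, termOp_daggerT, Complex.ofReal_one, one_smul, sub_eq_add_neg]

/-- A term list IS the `ℂ`-combination of its own words, indexed by positions. [folklore] -/
theorem termOp_eq_sum_get {ι : Type*} [LinearOrder ι] [Fintype ι] (d : α → ι) (CW : Terms α) :
    termOp d CW = ∑ j : Fin CW.length, (((CW.get j).2 : ℚ) : ℂ) • ladderWord (wmap d (CW.get j).1) := by
  rw [termOp, list_sum_map_eq_sum_fin]

end Semantics

/-! ## The kernel form of the soundness theorem -/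

section KernelForm

variable {α β : Type*} [LinearOrder α]

/-- **KERNEL FORM: syntactic window certificate + `q ≤ lowerConst (normalize residual) + (Σμ)(n₀/2 − ν)` ⇒ the affine-N
claim-node predicate** `SquareTTPrimeCorrAffineOrbitLowerRowN tp U q hi lo κhi κlo s n₀ S Λ' (termOp d TX)` — no certificate
identity hypothesis; see the module docstring for the data and the dictionary hypotheses. [cite: WangEtAl2024, §III]
[cite: JanssonChaykinKeil2008, §3] -/
theorem affineOrbitLowerRowN_of_kernelCert
    (tp U : ℚ) (hU : 0 ≤ U)
    {Λ Λ' : Finset (Site 2)} (hΛ : Λ ⊆ Λ') (h8 : thicken Λ 1 ⊆ Λ')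
    (h0 : thicken ({0} : Finset (Site 2)) 1 ⊆ Λ') (hz : (0 : Site 2) ∈ Λ')
    {S : Finset (DihedralGroup 4)} (h1 : (1 : DihedralGroup 4) ∈ S) (hmul : ∀ a ∈ S, ∀ b ∈ S, a * b ∈ S)
    -- letters
    (d : α → Orb (PolySite Λ')) (hd : Function.Injective d) (enc : α → ℕ) (Bkey : ℕ)
    (dΛ : β → Orb (PolySite Λ)) (f : β → α) (hf : ∀ b, d (f b) = Orb.embMap (PolySite.incl hΛ) (dΛ b))
    (sp : α → Fin 2) (hsp : ∀ a, (ofLex (d a)).2 = sp a)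
    -- dictionaries
    (TH : Terms α) (hH : termOp d TH = (hubbardTTPrimeFermionInteraction 1 tp U).localHamiltonian Λ')
    (TE : Terms α)
    (hE : termOp d TE = fermionEmbed (PolySite.incl h0) ((hubbardTTPrimeFermionInteraction 1 tp U).meanEnergyObs 1))
    (o : Fin 2 → α) (ho : ∀ σ, d (o σ) = orb (PolySite.pt 0 hz) σ)
    -- certificate data
    (TX : Terms α) (μ : Fin 2 → ℚ) (ν κhi hi κlo lo : ℚ) (K : ℕ) (Q : List (Terms α)) (EB : List (Terms β))
    {nS : ℕ} (γ : Fin nS → DihedralGroup 4) (hγS : ∀ l, γ l ∈ S) (wv : Fin nS → Site 2)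
    (hsh : ∀ l, d4ShiftSet (γ l) (wv l) Λ ⊆ Λ') (g : Fin nS → β → α)
    (hg : ∀ l b, d (g l b) = Orb.embMap (PolySite.incl (hsh l)) (Orb.embMap (PolySite.d4Emb (γ l) (wv l) Λ) (dΛ b)))
    (SY : Fin nS → Terms β)
    (CW : Terms α) (hcw : ∀ wc ∈ CW, chargeW wc.1 ≠ 0 ∨ spinChargeW sp wc.1 ≠ 0)
    (AV : List (Terms α))
    -- the ONE rational inequality
    {q s n₀ : ℚ} (hs : s = (μ 0 + μ 1) / 2)
    (hq : q ≤ lowerConst (CARPoly.normalize enc Bkey (residT TX μ ν o κhi hi κlo lo TE K Q TH f EB g SY CW AV)) +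
      (μ 0 + μ 1) * (n₀ / 2 - ν)) :
    SquareTTPrimeCorrAffineOrbitLowerRowN (tp : ℝ) (U : ℝ) q hi lo κhi κlo s n₀ S Λ' (termOp d TX) := by
  intro x hx0 hx2 ω Ls ψ hLs hψ hψ1 hω
  -- names
  set R : CARPoly.Poly α := CARPoly.normalize enc Bkey (residT TX μ ν o κhi hi κlo lo TE K Q TH f EB g SY CW AV) with hR
  set HΛ' : FermionOp Λ' := (hubbardTTPrimeFermionInteraction 1 (tp : ℝ) (U : ℝ)).localHamiltonian Λ' with hHΛ'
  set EΦ : FermionOp Λ' := fermionEmbed (PolySite.incl h0) ((hubbardTTPrimeFermionInteraction 1 (tp : ℝ) (U : ℝ)).meanEnergyObs 1)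
    with hEΦ
  set Bsem : Fin EB.length → FermionOp Λ := fun k => termOp dΛ (EB.get k) with hBsem
  set Ysem : Fin nS → FermionOp Λ := fun l => termOp dΛ (SY l) with hYsem
  set Vsem : Fin AV.length → FermionOp Λ' := fun m => termOp d (AV.get m) with hVsem
  set cwsem : Fin CW.length → List (Orb (PolySite Λ') × Bool) := fun j => wmap d (CW.get j).1 with hcwsem
  set bsem : Fin CW.length → ℂ := fun j => (((CW.get j).2 : ℚ) : ℂ) with hbsem
  -- the semantic pieces
  set Dn : FermionOp Λ' := ∑ σ : Fin 2, ((((μ σ : ℚ) : ℝ) : ℝ) : ℂ) • (nAt 0 hz σ - ((((ν : ℚ) : ℝ) : ℝ) : ℂ) • (1 : FermionOp Λ'))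
    with hDn
  set Er : FermionOp Λ' := ((((κhi : ℚ) : ℝ) : ℝ) : ℂ) • (((((hi : ℚ) : ℝ) : ℝ) : ℂ) • (1 : FermionOp Λ') - EΦ) +
      ((((κlo : ℚ) : ℝ) : ℝ) : ℂ) • (EΦ - ((((lo : ℚ) : ℝ) : ℝ) : ℂ) • (1 : FermionOp Λ')) with hEr
  set G : FermionOp Λ' := gramForm (1 : Matrix (Fin Q.length) (Fin Q.length) ℂ) (gramOp d K Q) with hG
  set EOM : FermionOp Λ' := ∑ k ∈ (Finset.univ : Finset (Fin EB.length)),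
      (HΛ' * fermionEmbed (PolySite.incl hΛ) (Bsem k) - fermionEmbed (PolySite.incl hΛ) (Bsem k) * HΛ') with hEOM
  set SYM : FermionOp Λ' := ∑ l ∈ (Finset.univ : Finset (Fin nS)),
      (fermionEmbed (PolySite.incl (hsh l)) (fermionEmbed (PolySite.d4Emb (γ l) (wv l) Λ) (Ysem l)) -
        fermionEmbed (PolySite.incl hΛ) (Ysem l)) with hSYM
  set CHG : FermionOp Λ' := ∑ j ∈ (Finset.univ : Finset (Fin CW.length)), bsem j • ladderWord (cwsem j) with hCHG
  set AH : FermionOp Λ' := ∑ m ∈ (Finset.univ : Finset (Fin AV.length)), (((1 : ℝ) : ℝ) : ℂ) • ((Vsem m)ᴴ - Vsem m)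
    with hAH
  set RES : FermionOp Λ' := ∑ k ∈ (Finset.univ : Finset (Fin R.length)), resCoeff R k • ladderWord (resWord d R k) with hRES
  -- casts
  have ec : ∀ r : ℚ, ((((r : ℚ) : ℝ) : ℝ) : ℂ) = ((r : ℚ) : ℂ) := fun r => Complex.ofReal_ratCast r
  -- (1) what the residual denotes
  have key : termOp d (residT TX μ ν o κhi hi κlo lo TE K Q TH f EB g SY CW AV) =
      termOp d TX - Dn - Er - G - EOM - SYM - CHG - AH := by
    have hD : termOp d ((finL 2).flatMap fun σ => scaleT (μ σ) (densT o ν σ)) = Dn := by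
      rw [termOp_flatMap_finL, hDn]
      refine Finset.sum_congr rfl fun σ _ => ?_
      rw [termOp_scaleT, termOp_densT d hz o ho, ec, ec]
    have hEr' : termOp d (scaleT κhi (unitT hi ++ negT TE)) + termOp d (scaleT κlo (TE ++ unitT (-lo))) = Er := by
      rw [termOp_scaleT, termOp_scaleT, termOp_append, termOp_append, termOp_negT, termOp_unitT, termOp_unitT, hE,
        hEr, ec, ec, ec, ec, Rat.cast_neg, neg_smul, ← sub_eq_add_neg, ← sub_eq_add_neg]
    have hGr : termOp d (gramT K Q) = G := by rw [hG, termOp_gramT_eq_gramForm]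
    have hEo : termOp d (eomTβ TH f EB) = EOM := by
      rw [termOp_eomTβ hΛ d dΛ f hf, hH, hEOM]
    have hSy : termOp d (symT f g SY) = SYM := by
      rw [termOp_symT hΛ d dΛ f hf γ wv hsh g hg, hSYM]
    have hCh : termOp d CW = CHG := by rw [termOp_eq_sum_get, hCHG]
    have hAh : termOp d (ahT AV) = AH := by rw [termOp_ahT, hAH]
    rw [residT, termOp_append, termOp_append, termOp_append, termOp_append, termOp_append, termOp_append, termOp_append,
      termOp_append, termOp_negT, termOp_negT, termOp_negT, termOp_negT, termOp_negT, termOp_negT, termOp_negT, termOp_negT,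
      hD, hGr, hEo, hSy, hCh, hAh, ← hEr']
    abel
  -- (2) the collected normal form denotes the same operator and splits into constant + residual family
  have hsplit : termOp d TX - Dn - Er - G - EOM - SYM - CHG - AH =
      ((((constCoeff R : ℚ) : ℝ) : ℝ) : ℂ) • (1 : FermionOp Λ') + RES := by
    rw [← key, ← evalPoly_normalize' hd enc Bkey, ← hR, ec, hRES]
    exact evalPoly_eq_const_add_residual d R
  -- (3) the tree's identity `hcert`, with `c := constCoeff R` and the residual family of `R`
  have hcert : termOp d TX - ((((constCoeff R : ℚ) : ℝ) : ℝ) : ℂ) • (1 : FermionOp Λ') -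
        ∑ σ : Fin 2, ((((μ σ : ℚ) : ℝ) : ℝ) : ℂ) • (nAt 0 hz σ - ((((ν : ℚ) : ℝ) : ℝ) : ℂ) • (1 : FermionOp Λ')) -
        ((((κhi : ℚ) : ℝ) : ℝ) : ℂ) • (((((hi : ℚ) : ℝ) : ℝ) : ℂ) • (1 : FermionOp Λ') - EΦ) -
        ((((κlo : ℚ) : ℝ) : ℝ) : ℂ) • (EΦ - ((((lo : ℚ) : ℝ) : ℝ) : ℂ) • (1 : FermionOp Λ')) =
      G + (EOM + SYM + CHG) + (AH + RES) := by
    rw [← hDn]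
    rw [← sub_eq_zero]
    have e : termOp d TX - ((((constCoeff R : ℚ) : ℝ) : ℝ) : ℂ) • (1 : FermionOp Λ') - Dn -
          ((((κhi : ℚ) : ℝ) : ℝ) : ℂ) • (((((hi : ℚ) : ℝ) : ℝ) : ℂ) • (1 : FermionOp Λ') - EΦ) -
          ((((κlo : ℚ) : ℝ) : ℝ) : ℂ) • (EΦ - ((((lo : ℚ) : ℝ) : ℝ) : ℂ) • (1 : FermionOp Λ')) -
          (G + (EOM + SYM + CHG) + (AH + RES)) =
        (termOp d TX - Dn - Er - G - EOM - SYM - CHG - AH) -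
          (((((constCoeff R : ℚ) : ℝ) : ℝ) : ℂ) • (1 : FermionOp Λ') + RES) := by
      rw [hEr]; abel
    rw [e, hsplit, sub_self]
  -- (4) the charged words are charged
  have hcw' : ∀ j ∈ (Finset.univ : Finset (Fin CW.length)), ladderCharge (cwsem j) ≠ 0 ∨ ladderSpinCharge (cwsem j) ≠ 0 := by
    intro j _
    rw [hcwsem]
    dsimp only
    rw [ladderCharge_wmap, ladderSpinCharge_wmap d sp hsp]
    exact hcw _ (List.get_mem CW j)
  -- (5) the Literature affine edge
  have hUr : (0 : ℝ) ≤ ((U : ℚ) : ℝ) := by exact_mod_cast hU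
  have hmain := hω.re_sum_expect_d4_ge_of_window_certificate_TT'_affine₂ 1 ((tp : ℚ) : ℝ) hUr hx0 hx2
    ((κhi : ℚ) : ℝ) ((hi : ℚ) : ℝ) ((κlo : ℚ) : ℝ) ((lo : ℚ) : ℝ) hΛ h8 h0 hz h1 hmul (termOp d TX)
    (fun σ => ((μ σ : ℚ) : ℝ)) ((ν : ℚ) : ℝ) (posSemidef_one_fin Q.length) (gramOp d K Q) Finset.univ Bsem Finset.univ γ
    (fun l _ => hγS l) wv hsh Ysem Finset.univ bsem cwsem hcw' Finset.univ (fun _ => (1 : ℝ)) Vsem Finset.univ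
    (resCoeff R) (resWord d R) hcert hLs hψ hψ1
  -- (6) the price is the engine's `lowerConst`
  have hlc := constCoeff_sub_sum_norm_resCoeff R
  have hμ : (∑ σ : Fin 2, ((μ σ : ℚ) : ℝ)) = ((μ 0 : ℚ) : ℝ) + ((μ 1 : ℚ) : ℝ) := Fin.sum_univ_two _
  have e2 : (((μ 0 : ℚ) : ℝ) + ((μ 1 : ℚ) : ℝ)) * (x / 2 - ((ν : ℚ) : ℝ)) =
      (((μ 0 : ℚ) : ℝ) + ((μ 1 : ℚ) : ℝ)) * (((n₀ : ℚ) : ℝ) / 2 - ((ν : ℚ) : ℝ)) +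
        (((μ 0 : ℚ) : ℝ) + ((μ 1 : ℚ) : ℝ)) / 2 * (x - ((n₀ : ℚ) : ℝ)) := by
    ring
  rw [hμ, e2, hlc] at hmain
  have hq' : ((q : ℚ) : ℝ) ≤ ((lowerConst R : ℚ) : ℝ) +
      (((μ 0 : ℚ) : ℝ) + ((μ 1 : ℚ) : ℝ)) * (((n₀ : ℚ) : ℝ) / 2 - ((ν : ℚ) : ℝ)) := by
    have h2 : ((q : ℚ) : ℝ) ≤ (((lowerConst R + (μ 0 + μ 1) * (n₀ / 2 - ν) : ℚ)) : ℝ) := by exact_mod_cast hq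
    push_cast at h2
    linarith
  have hs' : ((s : ℚ) : ℝ) = (((μ 0 : ℚ) : ℝ) + ((μ 1 : ℚ) : ℝ)) / 2 := by
    rw [hs]; push_cast; ring
  rw [hs']
  linarith

end KernelForm

end CARPolyWindow

end Summit.Ventures.CertifiedManyBodySolver

end
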